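import Literature.NumberTheory.LFunctions.Zhang2022.Section9Gathering
import Literature.NumberTheory.LFunctions.Zhang2022.RepairGapSection12Top1225Premise
import Literature.NumberTheory.LFunctions.Zhang2022.RepairGapLemma84LeafUnconditional
import HarnessLib

/-!
# Zhang (2022), rescue GAP/BED (D-0124 (3)(4)): §9 p. 51 — the gathering (G9) of `S_j(𝐚₁₂,𝐚₂₂)` (input of (9.7)) under the
# minimum premise `‖L(1,χ)‖ ≤ 𝓛⁻¹⁵`, UNCONDITIONAL

Topic `Literature/NumberTheory/LFunctions/Zhang2022` (Landau–Siegel audit tree; verdict-neutral).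
Y. Zhang, *Discrete mean estimates and the Landau–Siegel zero*, arXiv:2211.02515v1 (2022)
[Zhang2022LandauSiegel] — **an unrefereed manuscript under adjudication; nothing in this file asserts or
denies its Theorems 1–2, and nothing here is a claim about Landau–Siegel zeros. The programme SEARCHES and
TYPES; no claim about Landau–Siegel zeros, Theorems 1–2 of arXiv:2211.02515 or a repaired Margin232 until a
kernel theorem says so.**

The gathering (G9) — `S_j(𝐚₁₂,𝐚₂₂) = L′(1,χ)²·[gathered main terms] + o(α)`, the hypothesis of
`Section9PartialSummation.step9u004r_of_gathering9` behind the whole-DAG binder `h9u004r` (node Z22:§9.u004, reading (r), the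
§9 input of the (9.7) evaluation) — is a tree theorem through `Section9Gathering.gathering9_of_lemma84Rel` over: the Lemma 8.2
applications §8.u041 / §9.u002, the relative twins §8.u043 / §9.u003 of the Lemma 8.4 displays
(`Section8FrontEnd44ReductionRel.u043R_of_lemma84W`, `Section9Gathering.u9003R_of_lemma84W`, errors `C𝓛⁻¹⁵·(∏_{q∣dr}(1−q⁻¹)⁻¹)²`),
the guard-free tail mean and `core9Rel`. Assumption (A) is only THREADED; every input is kernel at exponent 15
(`Skeleton.lemma82_pow15` p592479, `Section8FrontEnd82.step8u041_pow15` p613435, `Section9Discharge.step9u002_sharp_pow15`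
p614362, `Skeleton.lemma84Rel_pow15` p608375). This file re-runs the four edges VERBATIM with the guard text swapped:
`Section8FrontEnd44ReductionRel.u043R_pow15W`, `Section9Gathering.u9003R_pow15W`, `gathering9_of_rel_pow15`, and
**`gathering9_pow15` — (G9) with guard `‖L(1,χ)‖ ≤ 𝓛⁻¹⁵`, every `c′ ≥ 0`, UNCONDITIONAL** (input of `RepairGapSection9U004Premise`).
Theorems only; no definition, no named fact; nothing about (A) itself.

## References

* Y. Zhang, arXiv:2211.02515v1 (2022), §9 p. 51 (tex L2598–L2618); §8 p. 47 (tex L2420–L2442), Lemmas 8.2–8.4.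
  [cite: Zhang2022LandauSiegel, §9 p.51]
-/

noncomputable section

open Complex Real ComplexConjugate Finset

/-! ## §8.u043 (relative, weighted) at `𝓛⁻¹⁵` -/

namespace Literature.NumberTheory.LFunctions.Zhang2022.Section8FrontEnd44ReductionRel

open Literature.NumberTheory.LFunctions.Zhang2022.Skeleton
open Literature.NumberTheory.LFunctions.Zhang2022.Section8FrontEnd82
open Literature.NumberTheory.LFunctions.Zhang2022.Section8FrontEnd84
open Literature.NumberTheory.LFunctions.Zhang2022.Section8FrontEnd44Sizes
open Literature.NumberTheory.LFunctions.Zhang2022.Section8FrontEnd44Reduction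

/-- **`Z22:§8.u043` with an error weight `W(dr)` ⇐ the Lemma 8.4 display with the same weight, BOTH GUARDED BY
`‖L(1,χ)‖ ≤ 𝓛⁻¹⁵`** (twin of `u043R_of_lemma84W`, proof verbatim; `μ = 7`, `y = P₂/dr`, constant `4|C|`).
[cite: Zhang2022LandauSiegel, §8 p.47, tex L2433] -/
theorem u043R_pow15W (c' : ℝ) {W : ℕ → ℝ} (hW : ∀ n, 0 ≤ W n)
    (h84 : ∃ C : ℝ, ForAllLarge fun D _ χ => ‖χ.LFunction 1‖ ≤ 1 / Real.log D ^ 15 →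
      ∀ j ∈ ({1, 2, 3} : Finset ℕ), ∀ μ ∈ ({6, 7} : Finset ℕ), ∀ d r : ℕ, 1 ≤ d → 1 ≤ r →
        ((d * r : ℕ) : ℝ) < bigP D / bigT D ^ 2 → ∀ y : ℝ, bigT D < y → y < bigP D →
          ‖(∑ n ∈ Finset.Ico 1 ⌈y⌉₊, χ (n : ZMod D) * xiZero c' D j n d r / (n : ℂ) *
                ((y / n : ℝ) : ℂ) ^ (-betaMu D μ) * (Real.log (y / n) : ℂ)) -
              deriv χ.LFunction 1 * PiW χ d r * frakgW c' D j μ y‖ ≤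
            C * (ell D ^ 6)⁻¹ * W (d * r)) :
    ∃ C : ℝ, ForAllLarge fun D _ χ => ‖χ.LFunction 1‖ ≤ 1 / Real.log D ^ 15 →
      ∀ j ∈ ({1, 2, 3} : Finset ℕ), ∀ d r : ℕ, 1 ≤ d → 1 ≤ r →
        ((d * r : ℕ) : ℝ) < Skeleton.P2 D / bigT D →
          ‖(∑ n ∈ Finset.Ico 1 (Nsupp D),
                χ (n : ZMod D) * conj (vk2 D (d * r * n)) * xiZero c' D j n d r / (n : ℂ)) -
              deriv χ.LFunction 1 * PiW χ d r / (Real.log (Skeleton.P2 D) : ℂ) *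
                frakgW c' D j 7 (Skeleton.P2 D / ((d * r : ℕ) : ℝ))‖ ≤
            C * (ell D ^ 15)⁻¹ * W (d * r) := by
  obtain ⟨C, D₀, h⟩ := h84
  refine ⟨4 * |C|, max D₀ ⌈Real.exp 2⌉₊, fun D _ χ hD hq hp hA j hj d r hd hr hdr => ?_⟩
  have hD₀ : D₀ ≤ D := le_trans (le_max_left _ _) hD
  have hL : 2 ≤ ell D := two_le_ell (le_trans (le_max_right _ _) hD)
  obtain ⟨-, hlogP2, -, hP2PT, -, hP2T, -, hP2P⟩ := params hL
  have hL0 : 0 < ell D := by linarith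
  have hT0 : 0 < bigT D := Real.exp_pos _
  have hdr1 : 1 ≤ d * r := Nat.one_le_iff_ne_zero.mpr (Nat.mul_ne_zero (by omega) (by omega))
  have hdr0 : (0 : ℝ) < ((d * r : ℕ) : ℝ) := by exact_mod_cast hdr1
  set x : ℝ := Skeleton.P2 D / ((d * r : ℕ) : ℝ) with hx
  have hP2x : Skeleton.P2 D = ((d * r : ℕ) : ℝ) * x := by rw [hx]; field_simp
  have hxT : bigT D < x := by
    rw [hx, lt_div_iff₀ hdr0]; rw [lt_div_iff₀ hT0] at hdr; linarith
  have hP2pos : 0 < Skeleton.P2 D :=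
    div_pos (Real.rpow_pos_of_pos (Real.exp_pos _) _) (pow_pos (Real.exp_pos _) _)
  have hxle : x ≤ Skeleton.P2 D := div_le_self hP2pos.le (by exact_mod_cast hdr1)
  have hxP : x < bigP D := lt_of_le_of_lt hxle hP2P
  have hT1 : 1 < bigT D := by
    rw [bigT]; exact Real.one_lt_exp_iff.mpr (by positivity)
  have hP2one : 1 < Skeleton.P2 D := lt_of_lt_of_le (lt_trans hT1 hxT) hxle
  have hdrPT : ((d * r : ℕ) : ℝ) < bigP D / bigT D ^ 2 := by
    have : Skeleton.P2 D / bigT D ≤ bigP D / bigT D ^ 2 := by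
      rw [div_le_div_iff₀ hT0 (by positivity)]; nlinarith
    exact lt_of_lt_of_le hdr this
  have key := h D χ hD₀ hq hp hA j hj 7 (by simp) d r hd hr hdrPT x hxT hxP
  have hWdr : 0 ≤ W (d * r) := hW _
  have key' : ‖(∑ n ∈ Finset.Ico 1 ⌈x⌉₊, χ (n : ZMod D) * xiZero c' D j n d r / (n : ℂ) *
        ((x / n : ℝ) : ℂ) ^ (-betaMu D 7) * (Real.log (x / n) : ℂ)) -
          deriv χ.LFunction 1 * PiW χ d r * frakgW c' D j 7 x‖ ≤
      |C| * (ell D ^ 6)⁻¹ * W (d * r) := by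
    refine key.trans ?_
    have hℓ : 0 ≤ (ell D ^ 6)⁻¹ := by positivity
    gcongr
    exact le_abs_self _
  have hsub : Finset.Ico 1 ⌈x⌉₊ ⊆ Finset.Ico 1 (Nsupp D) := Ico_ceil_subset hP2PT hdr1
  have hsum : (∑ n ∈ Finset.Ico 1 (Nsupp D),
        χ (n : ZMod D) * conj (vk2 D (d * r * n)) * xiZero c' D j n d r / (n : ℂ)) =
      (1 / (Real.log (Skeleton.P2 D) : ℂ)) *
        ∑ n ∈ Finset.Ico 1 ⌈x⌉₊, χ (n : ZMod D) * xiZero c' D j n d r / (n : ℂ) *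
          ((x / n : ℝ) : ℂ) ^ (-betaMu D 7) * (Real.log (x / n) : ℂ) := by
    rw [Finset.mul_sum]
    symm
    apply Finset.sum_subset_zero_on_sdiff hsub
    · intro n hn
      rw [Finset.mem_sdiff, Finset.mem_Ico, Finset.mem_Ico, not_and, not_lt] at hn
      have hxn : x ≤ n := Nat.ceil_le.mp (hn.2 hn.1.1)
      have : Skeleton.P2 D ≤ ((d * r * n : ℕ) : ℝ) := by
        rw [hP2x]; push_cast
        exact mul_le_mul_of_nonneg_left hxn (by positivity)
      rw [vk2_mul_eq_zero this, map_zero, mul_zero, zero_mul, zero_div]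
    · intro n hn
      rw [Finset.mem_Ico] at hn
      have hn1 : 1 ≤ n := hn.1
      have hnx : (n : ℝ) < x := Nat.lt_ceil.mp hn.2
      have hn0 : (0 : ℝ) < n := by exact_mod_cast hn1
      have hdrn : ((d * r * n : ℕ) : ℝ) < Skeleton.P2 D := by
        rw [hP2x]; push_cast
        have := mul_lt_mul_of_pos_left hnx hdr0
        push_cast at this; linarith
      rw [conj_vk2_mul_eq hP2one hdr1 hn1 hdrn]
      have hb : betaMu D 7 = beta7 D := by simp [betaMu]
      rw [hb, show Skeleton.P2 D / ((d * r : ℕ) : ℝ) / n = x / n by rw [hx]]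
      ring
  have hlog0 : 0 < Real.log (Skeleton.P2 D) := lt_of_lt_of_le (by positivity) hlogP2
  rw [hsum, show (1 / (Real.log (Skeleton.P2 D) : ℂ)) *
        (∑ n ∈ Finset.Ico 1 ⌈x⌉₊, χ (n : ZMod D) * xiZero c' D j n d r / (n : ℂ) *
          ((x / n : ℝ) : ℂ) ^ (-betaMu D 7) * (Real.log (x / n) : ℂ)) -
        deriv χ.LFunction 1 * PiW χ d r / (Real.log (Skeleton.P2 D) : ℂ) * frakgW c' D j 7 x =
      (1 / (Real.log (Skeleton.P2 D) : ℂ)) *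
        ((∑ n ∈ Finset.Ico 1 ⌈x⌉₊, χ (n : ZMod D) * xiZero c' D j n d r / (n : ℂ) *
          ((x / n : ℝ) : ℂ) ^ (-betaMu D 7) * (Real.log (x / n) : ℂ)) -
          deriv χ.LFunction 1 * PiW χ d r * frakgW c' D j 7 x) by ring, norm_mul]
  have hn : ‖(1 / (Real.log (Skeleton.P2 D) : ℂ))‖ = 1 / Real.log (Skeleton.P2 D) := by
    rw [norm_div, norm_one, Complex.norm_real, Real.norm_eq_abs, abs_of_pos hlog0]
  rw [hn]
  have hL9 : 0 < ell D ^ 9 := by positivity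
  have hinv : 1 / Real.log (Skeleton.P2 D) ≤ 4 / ell D ^ 9 := by
    rw [div_le_div_iff₀ hlog0 hL9]; linarith
  have hC0 : 0 ≤ |C| := abs_nonneg _
  calc 1 / Real.log (Skeleton.P2 D) * ‖(∑ n ∈ Finset.Ico 1 ⌈x⌉₊,
          χ (n : ZMod D) * xiZero c' D j n d r / (n : ℂ) * ((x / n : ℝ) : ℂ) ^ (-betaMu D 7) *
            (Real.log (x / n) : ℂ)) - deriv χ.LFunction 1 * PiW χ d r * frakgW c' D j 7 x‖
      ≤ 4 / ell D ^ 9 * (|C| * (ell D ^ 6)⁻¹ * W (d * r)) :=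
        mul_le_mul hinv key' (norm_nonneg _) (by positivity)
    _ = 4 * |C| * (ell D ^ 15)⁻¹ * W (d * r) := by field_simp

end Literature.NumberTheory.LFunctions.Zhang2022.Section8FrontEnd44ReductionRel

/-! ## §9.u003 (relative, weighted) and the gathering (G9) at `𝓛⁻¹⁵` -/

namespace Literature.NumberTheory.LFunctions.Zhang2022.Section9Gathering

open Literature.NumberTheory.LFunctions.Zhang2022.Skeleton
open Literature.NumberTheory.LFunctions.Zhang2022.Section8FrontEnd82
open Literature.NumberTheory.LFunctions.Zhang2022.Section8FrontEnd44Sizes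
open Literature.NumberTheory.LFunctions.Zhang2022.Section8FrontEnd44Reduction
open Literature.NumberTheory.LFunctions.Zhang2022.Section8FrontEnd44ReductionRel

/-- **`Z22:§9.u003` with an error weight ⇐ the Lemma 8.4 display with the same weight, BOTH GUARDED BY `‖L(1,χ)‖ ≤ 𝓛⁻¹⁵`**
(twin of `u9003R_of_lemma84W`, proof verbatim; `μ = 6`, `y = P₃/dr`). [cite: Zhang2022LandauSiegel, §9 p.51, tex L2609] -/
theorem u9003R_pow15W (c' : ℝ) {W : ℕ → ℝ} (hW : ∀ n, 0 ≤ W n)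
    (h84 : ∃ C : ℝ, ForAllLarge fun D _ χ => ‖χ.LFunction 1‖ ≤ 1 / Real.log D ^ 15 →
      ∀ j ∈ ({1, 2, 3} : Finset ℕ), ∀ μ ∈ ({6, 7} : Finset ℕ), ∀ d r : ℕ, 1 ≤ d → 1 ≤ r →
        ((d * r : ℕ) : ℝ) < bigP D / bigT D ^ 2 → ∀ y : ℝ, bigT D < y → y < bigP D →
          ‖(∑ n ∈ Finset.Ico 1 ⌈y⌉₊, χ (n : ZMod D) * xiZero c' D j n d r / (n : ℂ) *
                ((y / n : ℝ) : ℂ) ^ (-betaMu D μ) * (Real.log (y / n) : ℂ)) -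
              deriv χ.LFunction 1 * PiW χ d r * frakgW c' D j μ y‖ ≤
            C * (ell D ^ 6)⁻¹ * W (d * r)) :
    ∃ C : ℝ, ForAllLarge fun D _ χ => ‖χ.LFunction 1‖ ≤ 1 / Real.log D ^ 15 →
      ∀ j ∈ ({1, 2, 3} : Finset ℕ), ∀ d r : ℕ, 1 ≤ d → 1 ≤ r →
        ((d * r : ℕ) : ℝ) < Skeleton.P3 D / bigT D →
          ‖(∑ n ∈ Finset.Ico 1 (Nsupp D),
                χ (n : ZMod D) * conj (vk3 D (d * r * n)) * xiZero c' D j n d r / (n : ℂ)) -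
              deriv χ.LFunction 1 * PiW χ d r / (Real.log (Skeleton.P3 D) : ℂ) *
                frakgW c' D j 6 (Skeleton.P3 D / ((d * r : ℕ) : ℝ))‖ ≤
            C * (ell D ^ 15)⁻¹ * W (d * r) := by
  obtain ⟨C, D₀, h⟩ := h84
  refine ⟨3 * |C|, max D₀ ⌈Real.exp 4⌉₊, fun D _ χ hD hq hp hA j hj d r hd hr hdr => ?_⟩
  have hD₀ : D₀ ≤ D := le_trans (le_max_left _ _) hD
  have hL : 4 ≤ ell D := four_le_ell (le_trans (le_max_right _ _) hD)
  obtain ⟨hlogP3, -, hP3PT, hTP3, -, hP3P⟩ := params3 hL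
  have hL0 : 0 < ell D := by linarith
  have hT0 : 0 < bigT D := Real.exp_pos _
  have hdr1 : 1 ≤ d * r := Nat.one_le_iff_ne_zero.mpr (Nat.mul_ne_zero (by omega) (by omega))
  have hdr0 : (0 : ℝ) < ((d * r : ℕ) : ℝ) := by exact_mod_cast hdr1
  set x : ℝ := Skeleton.P3 D / ((d * r : ℕ) : ℝ) with hx
  have hP3x : Skeleton.P3 D = ((d * r : ℕ) : ℝ) * x := by rw [hx]; field_simp
  have hxT : bigT D < x := by
    rw [hx, lt_div_iff₀ hdr0]; rw [lt_div_iff₀ hT0] at hdr; linarith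
  have hP3pos : 0 < Skeleton.P3 D := Real.rpow_pos_of_pos (Real.exp_pos _) _
  have hxle : x ≤ Skeleton.P3 D := div_le_self hP3pos.le (by exact_mod_cast hdr1)
  have hxP : x < bigP D := lt_of_le_of_lt hxle hP3P
  have hT1 : 1 < bigT D := by
    rw [bigT]; exact Real.one_lt_exp_iff.mpr (by positivity)
  have hP3one : 1 < Skeleton.P3 D := lt_of_lt_of_le (lt_trans hT1 hxT) hxle
  have hdrPT : ((d * r : ℕ) : ℝ) < bigP D / bigT D ^ 2 :=
    lt_of_lt_of_le hdr ((div_le_self hP3pos.le hT1.le).trans hP3PT)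
  have key := h D χ hD₀ hq hp hA j hj 6 (by simp) d r hd hr hdrPT x hxT hxP
  have hWdr : 0 ≤ W (d * r) := hW _
  have key' : ‖(∑ n ∈ Finset.Ico 1 ⌈x⌉₊, χ (n : ZMod D) * xiZero c' D j n d r / (n : ℂ) *
        ((x / n : ℝ) : ℂ) ^ (-betaMu D 6) * (Real.log (x / n) : ℂ)) -
          deriv χ.LFunction 1 * PiW χ d r * frakgW c' D j 6 x‖ ≤
      |C| * (ell D ^ 6)⁻¹ * W (d * r) := by
    refine key.trans ?_
    have hℓ : 0 ≤ (ell D ^ 6)⁻¹ := by positivity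
    gcongr
    exact le_abs_self _
  have hsub : Finset.Ico 1 ⌈x⌉₊ ⊆ Finset.Ico 1 (Nsupp D) := Ico_ceil_subset hP3PT hdr1
  have hsum : (∑ n ∈ Finset.Ico 1 (Nsupp D),
        χ (n : ZMod D) * conj (vk3 D (d * r * n)) * xiZero c' D j n d r / (n : ℂ)) =
      (1 / (Real.log (Skeleton.P3 D) : ℂ)) *
        ∑ n ∈ Finset.Ico 1 ⌈x⌉₊, χ (n : ZMod D) * xiZero c' D j n d r / (n : ℂ) *
          ((x / n : ℝ) : ℂ) ^ (-betaMu D 6) * (Real.log (x / n) : ℂ) := by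
    rw [Finset.mul_sum]
    symm
    apply Finset.sum_subset_zero_on_sdiff hsub
    · intro n hn
      rw [Finset.mem_sdiff, Finset.mem_Ico, Finset.mem_Ico, not_and, not_lt] at hn
      have hxn : x ≤ n := Nat.ceil_le.mp (hn.2 hn.1.1)
      have : Skeleton.P3 D ≤ ((d * r * n : ℕ) : ℝ) := by
        rw [hP3x]; push_cast
        exact mul_le_mul_of_nonneg_left hxn (by positivity)
      rw [vk3_mul_eq_zero this, map_zero, mul_zero, zero_mul, zero_div]
    · intro n hn
      rw [Finset.mem_Ico] at hn
      have hn1 : 1 ≤ n := hn.1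
      have hnx : (n : ℝ) < x := Nat.lt_ceil.mp hn.2
      have hn0 : (0 : ℝ) < n := by exact_mod_cast hn1
      have hdrn : ((d * r * n : ℕ) : ℝ) < Skeleton.P3 D := by
        rw [hP3x]; push_cast
        have := mul_lt_mul_of_pos_left hnx hdr0
        push_cast at this; linarith
      rw [conj_vk3_mul_eq hP3one hdr1 hn1 hdrn]
      have hb : betaMu D 6 = beta6 D := by simp [betaMu]
      rw [hb, show Skeleton.P3 D / ((d * r : ℕ) : ℝ) / n = x / n by rw [hx]]
      ring
  have hlog0 : 0 < Real.log (Skeleton.P3 D) := by rw [hlogP3]; positivity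
  rw [hsum, show (1 / (Real.log (Skeleton.P3 D) : ℂ)) *
        (∑ n ∈ Finset.Ico 1 ⌈x⌉₊, χ (n : ZMod D) * xiZero c' D j n d r / (n : ℂ) *
          ((x / n : ℝ) : ℂ) ^ (-betaMu D 6) * (Real.log (x / n) : ℂ)) -
        deriv χ.LFunction 1 * PiW χ d r / (Real.log (Skeleton.P3 D) : ℂ) * frakgW c' D j 6 x =
      (1 / (Real.log (Skeleton.P3 D) : ℂ)) *
        ((∑ n ∈ Finset.Ico 1 ⌈x⌉₊, χ (n : ZMod D) * xiZero c' D j n d r / (n : ℂ) *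
          ((x / n : ℝ) : ℂ) ^ (-betaMu D 6) * (Real.log (x / n) : ℂ)) -
          deriv χ.LFunction 1 * PiW χ d r * frakgW c' D j 6 x) by ring, norm_mul]
  have hn : ‖(1 / (Real.log (Skeleton.P3 D) : ℂ))‖ = 1 / Real.log (Skeleton.P3 D) := by
    rw [norm_div, norm_one, Complex.norm_real, Real.norm_eq_abs, abs_of_pos hlog0]
  rw [hn]
  have hC0 : 0 ≤ |C| := abs_nonneg _
  calc 1 / Real.log (Skeleton.P3 D) * ‖(∑ n ∈ Finset.Ico 1 ⌈x⌉₊,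
          χ (n : ZMod D) * xiZero c' D j n d r / (n : ℂ) * ((x / n : ℝ) : ℂ) ^ (-betaMu D 6) *
            (Real.log (x / n) : ℂ)) - deriv χ.LFunction 1 * PiW χ d r * frakgW c' D j 6 x‖
      ≤ 1 / Real.log (Skeleton.P3 D) * (|C| * (ell D ^ 6)⁻¹ * W (d * r)) :=
        mul_le_mul_of_nonneg_left key' (by positivity)
    _ = |C| / 0.498 * (ell D ^ 15)⁻¹ * W (d * r) := by rw [hlogP3]; field_simp
    _ ≤ 3 * |C| * (ell D ^ 15)⁻¹ * W (d * r) := by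
        apply mul_le_mul_of_nonneg_right _ hWdr
        apply mul_le_mul_of_nonneg_right _ (by positivity)
        rw [div_le_iff₀ (by norm_num)]; nlinarith

/-- **(G9) from the four relative/`𝓛⁻¹⁵` inputs** (twin of `gathering9_of_rel`, proof verbatim; §8.u041 and §9.u002 via
`step8u041_pow15`, `Section9Discharge.step9u002_sharp_pow15 (lemma82_pow15)`). [cite: Zhang2022LandauSiegel, §9 p.51, tex L2613–L2618] -/
theorem gathering9_of_rel_pow15 {c' : ℝ} (hc' : 0 ≤ c')
    (h43 : ∃ C : ℝ, ForAllLarge fun D _ χ => ‖χ.LFunction 1‖ ≤ 1 / Real.log D ^ 15 →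
      ∀ j ∈ ({1, 2, 3} : Finset ℕ), ∀ d r : ℕ, 1 ≤ d → 1 ≤ r →
        ((d * r : ℕ) : ℝ) < Skeleton.P2 D / bigT D →
          ‖(∑ n ∈ Finset.Ico 1 (Nsupp D),
                χ (n : ZMod D) * conj (vk2 D (d * r * n)) * xiZero c' D j n d r / (n : ℂ)) -
              deriv χ.LFunction 1 * PiW χ d r / (Real.log (Skeleton.P2 D) : ℂ) *
                frakgW c' D j 7 (Skeleton.P2 D / ((d * r : ℕ) : ℝ))‖ ≤
            C * (ell D ^ 15)⁻¹ * (∏ q ∈ (d * r).primeFactors, (1 - (q : ℝ)⁻¹)⁻¹) ^ 2)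
    (h93 : ∃ C : ℝ, ForAllLarge fun D _ χ => ‖χ.LFunction 1‖ ≤ 1 / Real.log D ^ 15 →
      ∀ j ∈ ({1, 2, 3} : Finset ℕ), ∀ d r : ℕ, 1 ≤ d → 1 ≤ r →
        ((d * r : ℕ) : ℝ) < Skeleton.P3 D / bigT D →
          ‖(∑ n ∈ Finset.Ico 1 (Nsupp D),
                χ (n : ZMod D) * conj (vk3 D (d * r * n)) * xiZero c' D j n d r / (n : ℂ)) -
              deriv χ.LFunction 1 * PiW χ d r / (Real.log (Skeleton.P3 D) : ℂ) *
                frakgW c' D j 6 (Skeleton.P3 D / ((d * r : ℕ) : ℝ))‖ ≤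
            C * (ell D ^ 15)⁻¹ * (∏ q ∈ (d * r).primeFactors, (1 - (q : ℝ)⁻¹)⁻¹) ^ 2) :
    ∀ ε : ℝ, 0 < ε → ForAllLarge fun D _ χ => ‖χ.LFunction 1‖ ≤ 1 / Real.log D ^ 15 →
      ∀ j ∈ ({1, 2, 3} : Finset ℕ),
        ‖Sj c' D j (a12 χ) (a22 χ) -
            (deriv χ.LFunction 1 ^ 2 *
                (∑ n ∈ Finset.Ico 1 ⌈Skeleton.P3 D⌉₊, ∑ p ∈ Nat.divisorsAntidiagonal n,
                  ((ArithmeticFunction.moebius p.2).natAbs : ℂ) *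
                        (‖χ ((p.1 * p.2 : ℕ) : ZMod D)‖ : ℂ) /
                      (((p.1 * p.2 : ℕ) : ℂ) * (Nat.totient p.2 : ℂ)) *
                    lamZero c' D j (p.1 * p.2) * PiW χ p.1 p.2 *
                    ((conj iota3 * frakfW c' D j 6 (Skeleton.P3 D / n) / (Real.log (Skeleton.P3 D) : ℂ) +
                        conj iota4 * frakfW c' D j 7 (Skeleton.P2 D / n) / (Real.log (Skeleton.P2 D) : ℂ)) *
                      (iota3 * frakgW c' D j 6 (Skeleton.P3 D / n) / (Real.log (Skeleton.P3 D) : ℂ) +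
                        iota4 * frakgW c' D j 7 (Skeleton.P2 D / n) / (Real.log (Skeleton.P2 D) : ℂ)))) +
              deriv χ.LFunction 1 ^ 2 *
                (∑ n ∈ Finset.Ico ⌈Skeleton.P3 D⌉₊ ⌈Skeleton.P2 D⌉₊, ∑ p ∈ Nat.divisorsAntidiagonal n,
                  ((ArithmeticFunction.moebius p.2).natAbs : ℂ) *
                        (‖χ ((p.1 * p.2 : ℕ) : ZMod D)‖ : ℂ) /
                      (((p.1 * p.2 : ℕ) : ℂ) * (Nat.totient p.2 : ℂ)) *
                    lamZero c' D j (p.1 * p.2) * PiW χ p.1 p.2 *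
                    (conj iota4 * frakfW c' D j 7 (Skeleton.P2 D / n) / (Real.log (Skeleton.P2 D) : ℂ) *
                      (iota4 * frakgW c' D j 7 (Skeleton.P2 D / n) / (Real.log (Skeleton.P2 D) : ℂ)))))‖
          ≤ ε * alpha D := by
  intro ε hε
  obtain ⟨C41, D41, h41⟩ := step8u041_pow15 hc'
  obtain ⟨C92, D92, h92⟩ := Section9Discharge.step9u002_sharp_pow15 c' (lemma82_pow15 hc')
  obtain ⟨C43, D43, h43⟩ := h43
  obtain ⟨C93, D93, h93⟩ := h93
  obtain ⟨Cξ, Dξ, hξ⟩ := XiZeroMajorant.xiZeroTailMean c'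
  set C₁ : ℝ := max (max |C41| |C92|) (max |C43| |C93|) with hC₁def
  have h41le : |C41| ≤ C₁ := le_trans (le_max_left _ _) (le_max_left _ _)
  have h92le : |C92| ≤ C₁ := le_trans (le_max_right _ _) (le_max_left _ _)
  have h43le : |C43| ≤ C₁ := le_trans (le_max_left _ _) (le_max_right _ _)
  have h93le : |C93| ≤ C₁ := le_trans (le_max_right _ _) (le_max_right _ _)
  have hC₁ : 0 ≤ C₁ := (abs_nonneg C41).trans h41le
  set C₂ : ℝ := max Cξ 0 with hC₂def
  have hC₂ : 0 ≤ C₂ := le_max_right _ _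
  obtain ⟨K, hK0, hcore⟩ := core9Rel c' hC₁ hC₂
  set Dfin : ℕ := ⌈Real.exp (K ^ 10 / (ε * π) ^ 10)⌉₊ with hDfin
  refine ⟨max (max (max D41 D92) (max D43 D93)) (max Dξ (max ⌈Real.exp 4⌉₊ Dfin)),
    fun D _ χ hD hq hp hA j hj => ?_⟩
  have hD41 : D41 ≤ D :=
    le_trans (le_trans (le_max_left _ _) (le_max_left _ _)) (le_trans (le_max_left _ _) hD)
  have hD92 : D92 ≤ D :=
    le_trans (le_trans (le_max_right _ _) (le_max_left _ _)) (le_trans (le_max_left _ _) hD)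
  have hD43 : D43 ≤ D :=
    le_trans (le_trans (le_max_left _ _) (le_max_right _ _)) (le_trans (le_max_left _ _) hD)
  have hD93 : D93 ≤ D :=
    le_trans (le_trans (le_max_right _ _) (le_max_right _ _)) (le_trans (le_max_left _ _) hD)
  have hDξ : Dξ ≤ D := le_trans (le_max_left _ _) (le_trans (le_max_right _ _) hD)
  have hD4 : ⌈Real.exp 4⌉₊ ≤ D :=
    le_trans (le_trans (le_max_left _ _) (le_max_right _ _)) (le_trans (le_max_right _ _) hD)
  have hDf : Dfin ≤ D :=
    le_trans (le_trans (le_max_right _ _) (le_max_right _ _)) (le_trans (le_max_right _ _) hD)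
  have hL4 : 4 ≤ ell D := four_le_ell hD4
  have hL1 : 1 ≤ ell D := by linarith
  have hL0 : 0 < ell D := by linarith
  have hinv : ∀ {C : ℝ}, |C| ≤ C₁ → C * (ell D ^ 15)⁻¹ ≤ C₁ / ell D ^ 15 := by
    intro C hC
    rw [div_eq_mul_inv]
    exact mul_le_mul_of_nonneg_right ((le_abs_self C).trans hC) (by positivity)
  have hinvR : ∀ {C R : ℝ}, |C| ≤ C₁ → 0 ≤ R →
      C * (ell D ^ 15)⁻¹ * R ≤ C₁ / ell D ^ 15 * R := by
    intro C R hC hR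
    exact mul_le_mul_of_nonneg_right (hinv hC) hR
  have key := hcore hq hp hD4 j
    (fun d r hd hr hdr => (h41 D χ hD41 hq hp hA j hj d r hd hr hdr).trans (hinv h41le))
    (fun d r hd hr hdr => (h92 D χ hD92 hq hp hA j hj d r hd hr hdr).trans (hinv h92le))
    (fun d r hd hr hdr =>
      (h43 D χ hD43 hq hp hA j hj d r hd hr hdr).trans (hinvR h43le (sq_nonneg _)))
    (fun d r hd hr hdr =>
      (h93 D χ hD93 hq hp hA j hj d r hd hr hdr).trans (hinvR h93le (sq_nonneg _)))
    (fun d r hd hr hdr x hx1 hxT =>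
      (hξ D χ hDξ hq hp j hj d r hd hr hdr x hx1 hxT).trans
        (mul_le_mul_of_nonneg_right (mul_le_mul_of_nonneg_right (le_max_left _ _) hL0.le)
          (pow_nonneg (by linarith [Real.log_nonneg hx1]) 3)))
  have hLK : K ^ 10 / (ε * π) ^ 10 ≤ ell D := by
    have hexp : Real.exp (K ^ 10 / (ε * π) ^ 10) ≤ D :=
      le_trans (Nat.le_ceil _) (by exact_mod_cast hDf)
    exact (Real.le_log_iff_exp_le (lt_of_lt_of_le (Real.exp_pos _) hexp)).mpr hexp
  calc _ ≤ K * (ell D ^ (1.1 : ℝ)) ^ 7 / ell D ^ 17 := key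
    _ ≤ ε * π / ell D ^ 9 := final_small (by positivity) hL1 hLK
    _ = ε * alpha D := by rw [Section2.alpha_eq_pi_div_ell9]; ring

/-- **(G9) UNDER THE MINIMUM PREMISE, UNCONDITIONAL** (`c′ ≥ 0`): for every `ε > 0`, all large `D`, every real primitive `χ` with
`‖L(1,χ)‖ ≤ 𝓛⁻¹⁵`, `j ∈ {1,2,3}`: `‖S_j(𝐚₁₂,𝐚₂₂) − L′(1,χ)²·(gathered main terms)‖ ≤ εα` — twin of `gathering9_of_lemma84Rel` at
`Skeleton.lemma84Rel_pow15`. [cite: Zhang2022LandauSiegel, §9 p.51, tex L2613–L2618] -/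
theorem gathering9_pow15 {c' : ℝ} (hc' : 0 ≤ c') :
    ∀ ε : ℝ, 0 < ε → ForAllLarge fun D _ χ => ‖χ.LFunction 1‖ ≤ 1 / Real.log D ^ 15 →
      ∀ j ∈ ({1, 2, 3} : Finset ℕ),
        ‖Sj c' D j (a12 χ) (a22 χ) -
            (deriv χ.LFunction 1 ^ 2 *
                (∑ n ∈ Finset.Ico 1 ⌈Skeleton.P3 D⌉₊, ∑ p ∈ Nat.divisorsAntidiagonal n,
                  ((ArithmeticFunction.moebius p.2).natAbs : ℂ) *
                        (‖χ ((p.1 * p.2 : ℕ) : ZMod D)‖ : ℂ) /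
                      (((p.1 * p.2 : ℕ) : ℂ) * (Nat.totient p.2 : ℂ)) *
                    lamZero c' D j (p.1 * p.2) * PiW χ p.1 p.2 *
                    ((conj iota3 * frakfW c' D j 6 (Skeleton.P3 D / n) / (Real.log (Skeleton.P3 D) : ℂ) +
                        conj iota4 * frakfW c' D j 7 (Skeleton.P2 D / n) / (Real.log (Skeleton.P2 D) : ℂ)) *
                      (iota3 * frakgW c' D j 6 (Skeleton.P3 D / n) / (Real.log (Skeleton.P3 D) : ℂ) +
                        iota4 * frakgW c' D j 7 (Skeleton.P2 D / n) / (Real.log (Skeleton.P2 D) : ℂ)))) +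
              deriv χ.LFunction 1 ^ 2 *
                (∑ n ∈ Finset.Ico ⌈Skeleton.P3 D⌉₊ ⌈Skeleton.P2 D⌉₊, ∑ p ∈ Nat.divisorsAntidiagonal n,
                  ((ArithmeticFunction.moebius p.2).natAbs : ℂ) *
                        (‖χ ((p.1 * p.2 : ℕ) : ZMod D)‖ : ℂ) /
                      (((p.1 * p.2 : ℕ) : ℂ) * (Nat.totient p.2 : ℂ)) *
                    lamZero c' D j (p.1 * p.2) * PiW χ p.1 p.2 *
                    (conj iota4 * frakfW c' D j 7 (Skeleton.P2 D / n) / (Real.log (Skeleton.P2 D) : ℂ) *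
                      (iota4 * frakgW c' D j 7 (Skeleton.P2 D / n) / (Real.log (Skeleton.P2 D) : ℂ)))))‖
          ≤ ε * alpha D :=
  gathering9_of_rel_pow15 hc'
    (Section8FrontEnd44ReductionRel.u043R_pow15W c' (W := fun n => (∏ q ∈ n.primeFactors, (1 - (q : ℝ)⁻¹)⁻¹) ^ 2)
      (fun _ => sq_nonneg _) (Skeleton.lemma84Rel_pow15 c'))
    (u9003R_pow15W c' (W := fun n => (∏ q ∈ n.primeFactors, (1 - (q : ℝ)⁻¹)⁻¹) ^ 2)
      (fun _ => sq_nonneg _) (Skeleton.lemma84Rel_pow15 c'))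

end Literature.NumberTheory.LFunctions.Zhang2022.Section9Gathering

end
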